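import Summits.NavierStokesRegularity.NavierStokesRegularity.Theorems.TypeILiouvilleTypeIliouvilleNoTypeIIStubActiveWindowsZoom
import Summits.NavierStokesRegularity.NavierStokesRegularity.Theorems.TypeILiouvilleTypeIliouvilleNoTypeIIStubActiveWindowsRegularity
import HarnessLib

/-!
# A Type-I velocity bound forces a BKM-sharp gradient bound
# (crux `TypeIliouvilleNoTypeII`, stmt-NavierStokesRegularity-0056, line `Sketch`
# (gradient-bkm-pivot), stub `stub_gradientSharp_of_typeI`)

Helper file (theorems only). For `ν > 0`, `T > 0` and a classical solution `(u, p)` of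
Navier–Stokes on `ℝ³ × [0, T)` which is Leray–Hopf from its rapidly decaying datum, a Type-I
velocity bound `‖u(t, x)‖ ≤ C₀/√(T - t)` near `T` implies the BKM-sharp gradient bound
`‖∇u(t, x)‖ ≤ C/(T - t)` near `T` (`stub_gradientSharp_of_typeI`): parabolic regularity at the
Type-I scale. On the two-sided window `[t - (T-t)/2, t + (T-t)/2] ⊂ (0, T)` one has
`‖u‖ ≤ M := C₁/√((T-t)/2)` with `C₁ = max C₀ 1`; its rescaled half-length is the constant
`k = C₁²/ν`; the window zoom `w = M⁻¹ u(t + ν s/M², x₀ + ν y/M)` is a unit-viscosity Oseen-mild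
field bounded by `1` on `(-k, k)` (`ImmortalZoom.windowZoom_*`), so `‖∇w(0, 0)‖ ≤ K(k)`
(`ImmortalZoom.exists_norm_iteratedFDeriv_le_of_bounded`, KNSS 2009 §4) and
`‖∇u(t, x₀)‖ = (M²/ν)‖∇w(0, 0)‖ ≤ 2 C₁² K/(ν (T - t))` (`ImmortalZoom.fderiv_windowZoom_zero`).
-/

noncomputable section

-- the summit and its single problem share the name (D-0017 nested layout)
set_option linter.dupNamespace false

open Set Function Filter Topology MeasureTheory Metric
open scoped NNReal ENNReal

namespace Summit.NavierStokesRegularity.NavierStokesRegularity.Theorems.TypeIliouvilleNoTypeII.GradientPivot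

open Literature.Analysis Literature.Analysis.FluidPDE
open Summit.NavierStokesRegularity.NavierStokesRegularity.Theorems.TypeIliouvilleNoTypeII.ImmortalZoom

/-- `ℝ³`. -/
local notation "E3" => EuclideanSpace ℝ (Fin 3)

/-- **A Type-I velocity bound forces a BKM-sharp gradient bound.**  For a classical solution on
`[0, T)`, Leray–Hopf from its rapidly decaying datum, `‖u(t,x)‖ ≤ C₀/√(T-t)` near `T` implies
`‖∇u(t,x)‖ ≤ C/(T-t)` near `T`: on the two-sided window `[t - (T-t)/2, t + (T-t)/2] ⊂ (0, T)` one
has `‖u‖ ≤ M := C₁/√((T-t)/2)`, `C₁ = max C₀ 1`, its rescaled half-length is the constant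
`k = C₁²/ν`, the window zoom `w = M⁻¹ u(t + ν s/M², x₀ + ν y/M)` is a unit-viscosity Oseen-mild
field bounded by `1` on `(-k, k)` (`ImmortalZoom.windowZoom_*`), so `‖∇w(0,0)‖ ≤ K(k)`
(`ImmortalZoom.exists_norm_iteratedFDeriv_le_of_bounded`) and
`‖∇u(t,x₀)‖ = (M²/ν)‖∇w(0,0)‖ ≤ 2 C₁² K/(ν (T-t))` (`ImmortalZoom.fderiv_windowZoom_zero`).
[cite: KochNadirashviliSereginSverak2009, §4 Prop. 4.1 (4.6), (4.10) (arXiv:0709.3599v1 p. 8)] -/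
theorem stub_gradientSharp_of_typeI (ν T : ℝ) (hν : 0 < ν) (hT : 0 < T) (u : ℝ → E3 → E3)
    (p : ℝ → E3 → ℝ) (hsol : IsClassicalNSSolutionOn (Ico 0 T) ν 0 u p)
    (hLH : IsLerayHopfOn T ν 0 (u 0) u) (hdec : HasRapidSpatialDecay (u 0))
    (hI : IsTypeIBlowup u T) :
    ∃ C : ℝ, ∀ᶠ t in 𝓝[<] T, ∀ x, ‖fderiv ℝ (u t) x‖ ≤ C / (T - t) := by
  -- ## Step 1: the Type-I bound on an interval `(tI, T)`, with a positive constant `C₁`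
  obtain ⟨C₀, hC₀⟩ := hI
  obtain ⟨tI, htI, hsubI⟩ := mem_nhdsLT_iff_exists_Ioo_subset.1 hC₀
  have htIT : tI < T := htI
  obtain ⟨C₁, hC₀C₁, hC₁⟩ : ∃ C₁ : ℝ, C₀ ≤ C₁ ∧ 0 < C₁ :=
    ⟨max C₀ 1, le_max_left _ _, lt_max_of_lt_right one_pos⟩
  have hbdI : ∀ s ∈ Ioo tI T, ∀ x, ‖u s x‖ ≤ C₁ / Real.sqrt (T - s) := fun s hs x => by
    have h : ‖u s x‖ ≤ C₀ / Real.sqrt (T - s) := hsubI hs x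
    have hsq : 0 < Real.sqrt (T - s) := Real.sqrt_pos.2 (by linarith [hs.2])
    exact h.trans (div_le_div_of_nonneg_right hC₀C₁ hsq.le)
  -- ## Step 2: the rescaled half-length `k = C₁²/ν` and the window-uniform gradient bound `K`
  obtain ⟨k, hkdef⟩ : ∃ k : ℝ, k = C₁ ^ 2 / ν := ⟨_, rfl⟩
  have hk : 0 < k := by rw [hkdef]; positivity
  obtain ⟨K, hK⟩ := exists_norm_iteratedFDeriv_le_of_bounded (1 : ℝ) 1 (a := -(k / 2))
    (b := k / 2) (δ := k / 4) (by linarith) (by positivity)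
  refine ⟨2 * C₁ ^ 2 * K / ν, ?_⟩
  -- ## Step 3: times `t` close to `T`: `max (T/3) ((2 tI + T)/3) < t < T`
  have ht₁ : max (T / 3) ((2 * tI + T) / 3) < T := max_lt (by linarith) (by linarith)
  filter_upwards [Ioo_mem_nhdsLT ht₁] with t ht x₀
  have hT3 : T / 3 < t := lt_of_le_of_lt (le_max_left _ _) ht.1
  have htI3 : (2 * tI + T) / 3 < t := lt_of_le_of_lt (le_max_right _ _) ht.1
  have htT : t < T := ht.2
  have hTt : 0 < T - t := by linarith
  have hTt2 : 0 < (T - t) / 2 := by linarith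
  have hν0 : ν ≠ 0 := hν.ne'
  have hC₁0 : C₁ ≠ 0 := hC₁.ne'
  have hTt0 : T - t ≠ 0 := hTt.ne'
  -- the level `M = C₁ / √((T-t)/2)`
  obtain ⟨M, hMdef⟩ : ∃ M : ℝ, M = C₁ / Real.sqrt ((T - t) / 2) := ⟨_, rfl⟩
  have hsq2 : 0 < Real.sqrt ((T - t) / 2) := Real.sqrt_pos.2 hTt2
  have hM : 0 < M := by rw [hMdef]; exact div_pos hC₁ hsq2
  have hM2 : M ^ 2 = C₁ ^ 2 / ((T - t) / 2) := by
    rw [hMdef, div_pow, Real.sq_sqrt hTt2.le]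
  have hwin : k * ν / M ^ 2 = (T - t) / 2 := by
    rw [hM2, hkdef]
    field_simp
  -- the physical window `[t - (T-t)/2, t + (T-t)/2]` lies in `(0, T)` and inside `(tI, T)`
  have hsub : Icc (t - k * ν / M ^ 2) (t + k * ν / M ^ 2) ⊆ Ioo 0 T := by
    rw [hwin]
    intro s hs
    exact ⟨by linarith [hs.1], by linarith [hs.2]⟩
  have hbd : ∀ s ∈ Icc (t - k * ν / M ^ 2) (t + k * ν / M ^ 2), ∀ x, ‖u s x‖ ≤ M := by
    rw [hwin, hMdef]
    intro s hs x
    have hsI : s ∈ Ioo tI T := ⟨by linarith [hs.1], by linarith [hs.2]⟩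
    have hTs : (T - t) / 2 ≤ T - s := by linarith [hs.2]
    exact (hbdI s hsI x).trans (div_le_div_of_nonneg_left hC₁.le hsq2 (Real.sqrt_le_sqrt hTs))
  -- ## Step 4: the window zoom is an Oseen-mild field bounded by `1` on `(-k, k)`
  have hmild : ∀ σ τ : ℝ, -k < σ → σ < τ → τ < k → ∀ y,
      (M⁻¹ • stPull (ν / M ^ 2) (ν / M) t x₀ u) τ y =
        UnboundedOperators.heatExtension ((M⁻¹ • stPull (ν / M ^ 2) (ν / M) t x₀ u) σ) (τ - σ) y -
          oseenDuhamel 1 σ (M⁻¹ • stPull (ν / M ^ 2) (ν / M) t x₀ u)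
            (M⁻¹ • stPull (ν / M ^ 2) (ν / M) t x₀ u) τ y := fun σ τ hσ hστ hτ y =>
    windowZoom_oseen hν hT hsol hLH hdec hM
      (windowZoom_time_mem hν hM hsub ⟨hσ, hστ.trans hτ⟩).1 hστ
      (windowZoom_time_mem hν hM hsub ⟨hσ.trans hστ, hτ⟩).2 y
  have hgrad : ‖iteratedFDeriv ℝ 1 ((M⁻¹ • stPull (ν / M ^ 2) (ν / M) t x₀ u) 0) 0‖ ≤ K :=
    hK (by linarith) (by linarith) (windowZoom_continuousOn (x₀ := x₀) hν hsol hM hsub)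
      (fun s hs => windowZoom_isWeaklyDivFree hν hsol hM hsub hs) hmild
      (fun s hs y => windowZoom_norm_le_one hν hM hbd hs y) 0 ⟨by linarith, by linarith⟩ 0
  -- ## Step 5: undo the zoom, `∇w(0)(0) = (ν/M²) ∇u(t)(x₀)`
  have hd : Differentiable ℝ (u t) :=
    (hsol.contDiff_velocity ⟨by linarith, htT⟩).differentiable (by simp)
  have hc : 0 < ν / M ^ 2 := by positivity
  rw [norm_iteratedFDeriv_one, fderiv_windowZoom_zero hM hd, norm_smul, Real.norm_eq_abs,
    abs_of_pos hc] at hgrad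
  calc ‖fderiv ℝ (u t) x₀‖ ≤ K / (ν / M ^ 2) := (le_div_iff₀' hc).2 hgrad
    _ = 2 * C₁ ^ 2 * K / ν / (T - t) := by
      rw [hM2]
      field_simp

end Summit.NavierStokesRegularity.NavierStokesRegularity.Theorems.TypeIliouvilleNoTypeII.GradientPivot

end
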